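import Mathlib

/-!
# ValiantsHypothesis / BinomialElusive — multiplicative independence of the trinomials `X^A + X^B - β`

Support file for crux `BinomialMapsElusive` (stmt-ValiantsHypothesis-7393), first half of the
"translated toric maps" theorem (`Theorems/BinomialElusiveBinomialMapsElusiveAffineMonomial.lean`).

For exponents `0 < A_i < B_i` with `A` injective, gaps `B_i - A_i` injective and no gap equal to an
exponent, the power series `P_i = X^{A_i} + X^{B_i} - β_i` (`β_i ∈ ℂ` arbitrary) admit no identity
`a₋ ∏ P_i^{k⁺_i} = a₊ ∏ P_i^{k⁻_i}` with nonzero constants and disjointly supported exponent vectors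
not both zero (`no_trinomial_identity`).  Tool: the order `δ(φ) = ord(φ - φ(0))` of the non-constant
part of a series with nonzero constant term; `δ` of a product of such series with pairwise distinct
`δ`'s is the minimum (`delta_mul_of_lt`, `delta_pow`, `delta_prod`), and after stripping powers of `X`
one has `δ(Q_i) = B_i - A_i` (`β_i = 0`) resp. `A_i` (`β_i ≠ 0`), pairwise distinct.  Elementary;
characteristic zero is used in `delta_pow` (`k β ≠ 0`).
-/

namespace Summit.ValiantsHypothesis.ValiantsHypothesis.Theorems.BinomialElusiveAffineMonomial

-- summit = sub-problem name (single-conjunct summit, D-0017 layout), so the namespace repeats it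
set_option linter.dupNamespace false

open scoped BigOperators
open PowerSeries

section Delta

variable {F : Type*} [Field F]

/-- A series with nonzero constant coefficient has order `0`. -/
theorem order_eq_zero_of_constantCoeff_ne_zero {ψ : F⟦X⟧} (hψ : constantCoeff ψ ≠ 0) :
    ψ.order = 0 := by
  have h : ψ.order = ((0 : ℕ) : ℕ∞) := by
    rw [order_eq_nat]
    exact ⟨by simpa [coeff_zero_eq_constantCoeff] using hψ, fun i hi => by omega⟩
  simpa using h

/-- The order of a nonzero constant is `0`. -/
theorem order_C_of_ne_zero {c : F} (hc : c ≠ 0) : (C c : F⟦X⟧).order = 0 :=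
  order_eq_zero_of_constantCoeff_ne_zero (by rwa [constantCoeff_C])

/-- `δ` is unchanged by a nonzero constant factor. -/
theorem delta_C_mul {c : F} (hc : c ≠ 0) (φ : F⟦X⟧) : ((C c * φ) - C (constantCoeff (C c * φ))).order = (φ - C (constantCoeff φ)).order := by
  have h : C c * φ - C (constantCoeff (C c * φ)) = C c * (φ - C (constantCoeff φ)) := by
    rw [map_mul, constantCoeff_C, map_mul, mul_sub]
  rw [h, order_mul, order_C_of_ne_zero hc, zero_add]

/-- `δ` of a product of two series with nonzero constant terms and different `δ` is the smaller one. -/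
theorem delta_mul_of_lt {φ ψ : F⟦X⟧} (hφ : constantCoeff φ ≠ 0) (hψ : constantCoeff ψ ≠ 0)
    (h : (φ - C (constantCoeff φ)).order < (ψ - C (constantCoeff ψ)).order) : ((φ * ψ) - C (constantCoeff (φ * ψ))).order = (φ - C (constantCoeff φ)).order := by
  set a := constantCoeff φ
  set b := constantCoeff ψ
  have hsplit : φ * ψ - C (constantCoeff (φ * ψ)) = (φ - C a) * ψ + C a * (ψ - C b) := by
    rw [map_mul, map_mul]; ring
  have hψ0 : ψ.order = 0 := order_eq_zero_of_constantCoeff_ne_zero hψ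
  have h1 : ((φ - C a) * ψ).order = (φ - C a).order := by rw [order_mul, hψ0, add_zero]
  have h2 : (C a * (ψ - C b)).order = (ψ - C b).order := by
    rw [order_mul, order_C_of_ne_zero hφ, zero_add]
  rw [hsplit, order_add_of_order_ne _ _ (by rw [h1, h2]; exact h.ne), h1, h2, min_eq_left h.le]

/-- `δ` of a positive power of a series with nonzero constant term (characteristic zero). -/
theorem delta_pow [CharZero F] {φ : F⟦X⟧} (hφ : constantCoeff φ ≠ 0) {k : ℕ} (hk : 0 < k) :
    ((φ ^ k) - C (constantCoeff (φ ^ k))).order = (φ - C (constantCoeff φ)).order := by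
  set a := constantCoeff φ
  have hgeom : φ ^ k - C (constantCoeff (φ ^ k))
      = (∑ i ∈ Finset.range k, φ ^ i * (C a) ^ (k - 1 - i)) * (φ - C a) := by
    rw [map_pow, map_pow]
    exact (geom_sum₂_mul φ (C a) k).symm
  have hS : constantCoeff (∑ i ∈ Finset.range k, φ ^ i * (C a) ^ (k - 1 - i)) = k * a ^ (k - 1) := by
    rw [map_sum]
    have : ∀ i ∈ Finset.range k, constantCoeff (φ ^ i * (C a) ^ (k - 1 - i)) = a ^ (k - 1) := by
      intro i hi
      rw [map_mul, map_pow, map_pow, constantCoeff_C, ← pow_add]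
      congr 1; have := Finset.mem_range.mp hi; omega
    rw [Finset.sum_congr rfl this, Finset.sum_const, Finset.card_range, nsmul_eq_mul]
  have hS0 : (∑ i ∈ Finset.range k, φ ^ i * (C a) ^ (k - 1 - i)).order = 0 := by
    refine order_eq_zero_of_constantCoeff_ne_zero ?_
    rw [hS]
    exact mul_ne_zero (by exact_mod_cast hk.ne') (pow_ne_zero _ hφ)
  rw [hgeom, order_mul, hS0, zero_add]

/-- `δ` of a product `∏_{i ∈ S} Q_i^{k_i}` of series with nonzero constant terms, positive exponents
and pairwise distinct finite `δ(Q_i) = e_i`: it equals `e_i` for some `i ∈ S` whose `e_i` is minimal. -/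
theorem delta_prod [CharZero F] {ι : Type*} (S : Finset ι) (hS : S.Nonempty) (Q : ι → F⟦X⟧)
    (k e : ι → ℕ) (hQ : ∀ i ∈ S, constantCoeff (Q i) ≠ 0) (hk : ∀ i ∈ S, 0 < k i)
    (he : ∀ i ∈ S, ((Q i) - C (constantCoeff (Q i))).order = e i) (hinj : Set.InjOn e S) :
    ∃ i ∈ S, ((∏ j ∈ S, Q j ^ k j) - C (constantCoeff (∏ j ∈ S, Q j ^ k j))).order = e i ∧ ∀ j ∈ S, e i ≤ e j := by
  classical
  induction S using Finset.strongInduction with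
  | H S ih =>
    -- the index of minimal `e` in `S`
    obtain ⟨i₀, hi₀, hmin⟩ := S.exists_min_image e hS
    refine ⟨i₀, hi₀, ?_, hmin⟩
    rw [← Finset.mul_prod_erase S _ hi₀]
    by_cases hT : (S.erase i₀).Nonempty
    · obtain ⟨i₁, hi₁, hδ, -⟩ := ih (S.erase i₀) (Finset.erase_ssubset hi₀) hT
        (fun i hi => hQ i (Finset.mem_of_mem_erase hi)) (fun i hi => hk i (Finset.mem_of_mem_erase hi))
        (fun i hi => he i (Finset.mem_of_mem_erase hi)) (hinj.mono (Finset.erase_subset i₀ S))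
      have hlt : e i₀ < e i₁ := by
        have hne : i₁ ≠ i₀ := Finset.ne_of_mem_erase hi₁
        have hle := hmin i₁ (Finset.mem_of_mem_erase hi₁)
        exact lt_of_le_of_ne hle (fun h => hne (hinj (Finset.mem_of_mem_erase hi₁) hi₀ h.symm))
      have hpow : ((Q i₀ ^ k i₀) - C (constantCoeff (Q i₀ ^ k i₀))).order = e i₀ := by rw [delta_pow (hQ i₀ hi₀) (hk i₀ hi₀), he i₀ hi₀]
      rw [delta_mul_of_lt ?_ ?_ ?_, hpow]
      · rw [map_pow]; exact pow_ne_zero _ (hQ i₀ hi₀)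
      · rw [map_prod]
        exact Finset.prod_ne_zero_iff.mpr fun j hj => by
          rw [map_pow]; exact pow_ne_zero _ (hQ j (Finset.mem_of_mem_erase hj))
      · rw [hpow, hδ]; exact_mod_cast hlt
    · rw [Finset.not_nonempty_iff_eq_empty.mp hT, Finset.prod_empty, mul_one,
        delta_pow (hQ i₀ hi₀) (hk i₀ hi₀), he i₀ hi₀]

/-- A nonzero constant has `δ = ⊤`. -/
theorem delta_C (c : F) : ((C c : F⟦X⟧) - C (constantCoeff (C c : F⟦X⟧))).order = ⊤ := by
  rw [constantCoeff_C, sub_self, order_zero]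

end Delta

section Core

/-- **Multiplicative independence of the trinomials `X^{A_i} + X^{B_i} - β_i` modulo constants.**
With `0 < A_i < B_i`, `A` injective, gaps `B_i - A_i` injective and never equal to an exponent `A_j`,
there is no identity `a₋ ∏_i P_i^{k⁺_i} = a₊ ∏_i P_i^{k⁻_i}` with nonzero constants, disjointly
supported exponent vectors `k⁺, k⁻ : Fin m → ℕ`, not both zero. -/
theorem no_trinomial_identity {m : ℕ} (A B : Fin m → ℕ) (hA : ∀ i, 0 < A i) (hAB : ∀ i, A i < B i)
    (hAinj : Function.Injective A) (hcinj : Function.Injective fun i => B i - A i)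
    (hcA : ∀ i j, B i - A i ≠ A j) (β : Fin m → ℂ) (kp km : Fin m → ℕ)
    (hdisj : ∀ i, kp i = 0 ∨ km i = 0) (hne : kp ≠ 0 ∨ km ≠ 0) (ap am : ℂ) (hap : ap ≠ 0)
    (ham : am ≠ 0)
    (hid : C am * ∏ i, ((PowerSeries.X : ℂ⟦X⟧) ^ (A i) + PowerSeries.X ^ (B i) - PowerSeries.C (β i)) ^ kp i = C ap * ∏ i, ((PowerSeries.X : ℂ⟦X⟧) ^ (A i) + PowerSeries.X ^ (B i) - PowerSeries.C (β i)) ^ km i) :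
    False := by
  classical
  -- strip the powers of `X`: `P_i = X^{v_i} Q_i` with `Q_i(0) ≠ 0`
  let v : Fin m → ℕ := fun i => if β i = 0 then A i else 0
  let Q : Fin m → ℂ⟦X⟧ := fun i => if β i = 0 then 1 + X ^ (B i - A i) else ((PowerSeries.X : ℂ⟦X⟧) ^ (A i) + PowerSeries.X ^ (B i) - PowerSeries.C (β i))
  let e : Fin m → ℕ := fun i => if β i = 0 then B i - A i else A i
  have hPQ : ∀ i, ((PowerSeries.X : ℂ⟦X⟧) ^ (A i) + PowerSeries.X ^ (B i) - PowerSeries.C (β i)) = X ^ v i * Q i := by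
    intro i
    by_cases hb : β i = 0
    · simp only [v, Q, if_pos hb, hb, map_zero, sub_zero, mul_add, mul_one, ← pow_add,
        Nat.add_sub_cancel' (hAB i).le]
    · simp only [v, Q, if_neg hb, pow_zero, one_mul]
  have hQ0 : ∀ i, constantCoeff (Q i) ≠ 0 := by
    intro i
    by_cases hb : β i = 0
    · simp only [Q, if_pos hb, map_add, map_one, map_pow, constantCoeff_X,
        zero_pow (Nat.sub_ne_zero_of_lt (hAB i)), add_zero]
      exact one_ne_zero
    · simp only [Q, if_neg hb, map_sub, map_add, map_pow, constantCoeff_X, constantCoeff_C,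
        zero_pow (hA i).ne', zero_pow (Nat.ne_of_gt (lt_trans (hA i) (hAB i))), add_zero, zero_sub,
        neg_ne_zero]
      exact hb
  have hQe : ∀ i, ((Q i) - C (constantCoeff (Q i))).order = e i := by
    intro i
    by_cases hb : β i = 0
    · simp only [Q, e, if_pos hb, map_add, map_one, map_pow, constantCoeff_X,
        zero_pow (Nat.sub_ne_zero_of_lt (hAB i)), add_zero, map_one, add_sub_cancel_left, order_X_pow]
    · simp only [Q, e, if_neg hb, map_sub, map_add, map_pow, constantCoeff_X,
        constantCoeff_C, zero_pow (hA i).ne', zero_pow (Nat.ne_of_gt (lt_trans (hA i) (hAB i))),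
        add_zero, zero_sub, map_neg, sub_neg_eq_add, sub_add_cancel]
      rw [order_add_of_order_ne _ _ (by rw [order_X_pow, order_X_pow]; exact_mod_cast (hAB i).ne),
        order_X_pow, order_X_pow]
      exact min_eq_left (by exact_mod_cast (hAB i).le)
  have heinj : Function.Injective e := by
    intro i j hij
    simp only [e] at hij
    by_cases hi : β i = 0 <;> by_cases hj : β j = 0 <;> simp only [hi, hj, if_true, if_false] at hij
    · exact hcinj hij
    · exact absurd hij (hcA i j)
    · exact absurd hij.symm (hcA j i)
    · exact hAinj hij
  -- the identity with powers of `X` stripped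
  have hprod : ∀ k : Fin m → ℕ, ∏ i, ((PowerSeries.X : ℂ⟦X⟧) ^ (A i) + PowerSeries.X ^ (B i) - PowerSeries.C (β i)) ^ k i
      = X ^ (∑ i, v i * k i) * ∏ i, Q i ^ k i := by
    intro k
    rw [← Finset.prod_pow_eq_pow_sum, ← Finset.prod_mul_distrib]
    exact Finset.prod_congr rfl fun i _ => by rw [hPQ, mul_pow, pow_mul]
  have hQprod0 : ∀ k : Fin m → ℕ, constantCoeff (∏ i, Q i ^ k i) ≠ 0 := fun k => by
    rw [map_prod]; exact Finset.prod_ne_zero_iff.mpr fun i _ => by rw [map_pow]; exact pow_ne_zero _ (hQ0 i)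
  have hord : ∀ (a : ℂ) (k : Fin m → ℕ), a ≠ 0 →
      (C a * ∏ i, ((PowerSeries.X : ℂ⟦X⟧) ^ (A i) + PowerSeries.X ^ (B i) - PowerSeries.C (β i)) ^ k i).order = (∑ i, v i * k i : ℕ) := by
    intro a k ha
    rw [hprod, order_mul, order_mul, order_C_of_ne_zero ha, order_X_pow,
      order_eq_zero_of_constantCoeff_ne_zero (hQprod0 k), zero_add, add_zero]
  have hV : (∑ i, v i * kp i) = ∑ i, v i * km i := by
    have := congrArg PowerSeries.order hid
    rw [hord am kp ham, hord ap km hap] at this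
    exact_mod_cast this
  have hid' : C am * ∏ i, Q i ^ kp i = C ap * ∏ i, Q i ^ km i := by
    rw [hprod, hprod, ← hV, mul_left_comm, mul_left_comm (C ap)] at hid
    exact mul_left_cancel₀ (pow_ne_zero _ X_ne_zero) hid
  -- `δ` of both sides
  have hδ : ((∏ i, Q i ^ kp i) - C (constantCoeff (∏ i, Q i ^ kp i))).order = ((∏ i, Q i ^ km i) - C (constantCoeff (∏ i, Q i ^ km i))).order := by
    rw [← delta_C_mul ham, hid', delta_C_mul hap]
  -- restrict the products to the supports
  have hrestrict : ∀ k : Fin m → ℕ, ∏ i, Q i ^ k i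
      = ∏ i ∈ Finset.univ.filter (fun i => k i ≠ 0), Q i ^ k i := by
    intro k
    rw [Finset.prod_filter]
    exact Finset.prod_congr rfl fun i _ => by
      by_cases h : k i ≠ 0
      · rw [if_pos h]
      · rw [if_neg h, not_ne_iff.mp h, pow_zero]
  have hδsupp : ∀ k : Fin m → ℕ, (Finset.univ.filter (fun i => k i ≠ 0)).Nonempty →
      ∃ i, k i ≠ 0 ∧ ((∏ i, Q i ^ k i) - C (constantCoeff (∏ i, Q i ^ k i))).order = e i := by
    intro k hk
    obtain ⟨i, hi, hδi, -⟩ := delta_prod (Finset.univ.filter (fun i => k i ≠ 0)) hk Q k e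
      (fun i _ => hQ0 i) (fun i hi => Nat.pos_of_ne_zero (Finset.mem_filter.mp hi).2)
      (fun i _ => hQe i) (heinj.injOn)
    exact ⟨i, (Finset.mem_filter.mp hi).2, by rw [hrestrict k]; exact hδi⟩
  have hδempty : ∀ k : Fin m → ℕ, ¬ (Finset.univ.filter (fun i => k i ≠ 0)).Nonempty →
      ((∏ i, Q i ^ k i) - C (constantCoeff (∏ i, Q i ^ k i))).order = ⊤ := by
    intro k hk
    rw [hrestrict k, Finset.not_nonempty_iff_eq_empty.mp hk, Finset.prod_empty, ← map_one C, delta_C]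
  by_cases hp : (Finset.univ.filter (fun i => kp i ≠ 0)).Nonempty <;>
    by_cases hm : (Finset.univ.filter (fun i => km i ≠ 0)).Nonempty
  · obtain ⟨i, hi, hδi⟩ := hδsupp kp hp
    obtain ⟨j, hj, hδj⟩ := hδsupp km hm
    have hij : i ≠ j := by
      rintro rfl
      rcases hdisj i with h | h
      · exact hi h
      · exact hj h
    rw [hδi, hδj] at hδ
    exact hij (heinj (by exact_mod_cast hδ))
  · obtain ⟨i, hi, hδi⟩ := hδsupp kp hp
    rw [hδi, hδempty km hm] at hδ
    exact ENat.coe_ne_top _ hδ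
  · obtain ⟨j, hj, hδj⟩ := hδsupp km hm
    rw [hδj, hδempty kp hp] at hδ
    exact ENat.coe_ne_top _ hδ.symm
  · apply hne.elim
    · intro h; apply h; funext i
      by_contra hki
      exact hp ⟨i, Finset.mem_filter.mpr ⟨Finset.mem_univ _, hki⟩⟩
    · intro h; apply h; funext i
      by_contra hki
      exact hm ⟨i, Finset.mem_filter.mpr ⟨Finset.mem_univ _, hki⟩⟩

end Core

end Summit.ValiantsHypothesis.ValiantsHypothesis.Theorems.BinomialElusiveAffineMonomial
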